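import Literature.MathematicalPhysics.QuantumManyBody.BoseGasCatStates
import Literature.MathematicalPhysics.QuantumManyBody.NeumannMomentumCutoffs
import Literature.MathematicalPhysics.QuantumManyBody.PeriodicBoseGasThm31
import Literature.MathematicalPhysics.QuantumManyBody.OneParticleMarginals
import HarnessLib

/-!
# The free Dirichlet gas condenses: `HasGroundStateBEC 0 ρ` for every density

Topic `Literature/MathematicalPhysics/QuantumManyBody` (audit fact for the conjunct
`BoseEinsteinCondensation` of the summit `AtomisticToContinuum`, filed by the crux disprover of
`PeriodicToDirichlet`, stmt-AtomisticToContinuum-9483, gen 2). The conjunct quantifies over every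
repulsive finite-range `v`, including `v = 0`; this file proves its `v = 0` instance in the exact
formal sense of `BoseEinsteinCondensation.lean` (`condensateNumber` through `δ`-near-minimisers of
the Dirichlet energy in the `C¹` class, `λ_max` as a supremum of occupations over normalised
measurable modes):

* `hasGroundStateBEC_zero` — `HasGroundStateBEC 0 ρ` for every `ρ > 0`;
  `boseEinsteinCondensation_at_zero` — the conjunct's `∃ ρ₀ ∀ ρ < ρ₀` form at `v = 0`;
* `exists_condensateNumber_zero_ge` — uniformly: `∃ c > 0 ∀ N ≥ 1 ∀ L > 0, cN ≤ condensateNumber 0 N L`.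

Proof (Neumann bracketing into MACROSCOPIC sub-boxes + sub-box constant modes, the route the
planners of stmt-0827 expected, run at the one scale where it works — the kinetic gap):
* `key_inequality` — for a Dirichlet state `Ψ` of `Λ_L`, `L = kℓ`:
  `(π/ℓ)² N ≤ T(Ψ) + (π/ℓ)² ∑_q ⟨u_q, γ_Ψ u_q⟩`, `u_q = ℓ^{-3/2} 1_{Q_q}` the constant modes of the
  `k³` sub-cells `Q_q = ℓq + [0,ℓ)³` (`slice_key`: the SHARP Neumann gap `π²/ℓ²` of the cube — the
  cosine Parseval of `NeumannMomentumCutoffs` — applied on each translated sub-cell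
  (`local_poincare_cellShift`) to each slice `x ↦ Ψ(x, Y)`, summed over the partition
  (`sum_indicator_subCell`), integrated over `Y` and multiplied by `N` using Bose symmetry
  (`lintegral_kineticDensity_eq_mul`: `T = N ∫|∇₀Ψ|²`));
* `groundStateEnergy_zero_le` — `E₀^D(0,N,L) ≤ N 𝓔₀[β]/L²` by the dilated power state `β_L^{⊗N}`
  of the unit bump of `BoseGasCatStates`;
* choosing `k` with `k²π²/4 ≥ 𝓔₀[β]` and the slack `δ = (πk/L)²N/4`, every `δ`-near-minimiser has
  `∑_q ⟨u_q, γ u_q⟩ ≥ N/2`, so one sub-cell mode carries `≥ N/(2k³)`: `c = 1/(2k³)`.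

Why it is recorded: (i) the audited conjunct is not refutable at the free gas (no junk in
`condensateNumber`/`maxOccupation`/`TrialState` at `v = 0`), complementing the periodic side
(`periodicBEC_antecedent_free`, `KineticGapLengthScalesFreeGas.lean`): both sides of the crux
`PeriodicToDirichlet` hold at `v = 0`, so it has no ex-falso or cheap-counterexample exit there;
(ii) the bracketing-plus-mode route certifies `λ_max ≥ cN` exactly when the energy per particle
is `O(1)` sub-box gaps `π²/ℓ²` with `ℓ ∼ L` — true for the free gas (`T/N ∼ L⁻²`), false for
`v ≠ 0` (`T/N ∼ ρa ≫ L⁻²`): the barrier `KineticGapLengthScales` in action. Data definitions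
(`subOffset`, `cellShift`, `subCell`, `subMode`) and theorems; `[folklore]` / LSSY Ch. 5.

## References

* [LSSY2005] E. H. Lieb, R. Seiringer, J. P. Solovej, J. Yngvason, *The Mathematics of the Bose Gas
  and its Condensation* (2005), §1.2 (1.17)–(1.19); Ch. 5 (5.15)–(5.17) (Poincaré / gap method).
-/

noncomputable section

namespace Literature.MathematicalPhysics.QuantumManyBody.BoseGas

open _root_.MeasureTheory _root_.Filter _root_.Topology
open scoped ENNReal NNReal ComplexConjugate

variable {N n : ℕ}

/-! ### Partial gradients and Bose symmetry -/

/-- **Bose symmetry moves the partial gradient to particle `0`:**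
`|∇ᵢΨ|²(X) = |∇₀Ψ|²(X ∘ (0 i))`. [folklore] -/
theorem partialGradSq_eq_zero_comp_swap {Ψ : Config (n + 1) → ℂ} (hΨ : Differentiable ℝ Ψ)
    (hsymm : ∀ (σ : Equiv.Perm (Fin (n + 1))) (X : Config (n + 1)), Ψ (X ∘ σ) = Ψ X)
    (i : Fin (n + 1)) (X : Config (n + 1)) :
    partialGradSq i Ψ X = partialGradSq 0 Ψ (X ∘ Equiv.swap 0 i) := by
  set σ : Equiv.Perm (Fin (n + 1)) := Equiv.swap 0 i with hσ
  have hfun : Ψ = fun Y => Ψ (Y ∘ σ) := funext fun Y => (hsymm σ Y).symm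
  have hd : fderiv ℝ Ψ X = (fderiv ℝ Ψ (X ∘ σ)).comp (relabelCLM σ) := by
    conv_lhs => rw [hfun]
    have h1 : HasFDerivAt Ψ (fderiv ℝ Ψ (X ∘ σ)) (relabelCLM σ X) := (hΨ _).hasFDerivAt
    exact (h1.comp X (relabelCLM σ).hasFDerivAt).fderiv
  unfold partialGradSq
  refine Finset.sum_congr rfl fun k _ => ?_
  rw [hd, ContinuousLinearMap.comp_apply, relabelCLM_apply, single_comp_perm]
  simp [hσ]

/-- `∫ |∇ᵢΨ|² = ∫ |∇₀Ψ|²` for a Bose-symmetric `Ψ`. [folklore] -/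
theorem lintegral_partialGradSq_eq_zero {Ψ : Config (n + 1) → ℂ} (hΨ : Differentiable ℝ Ψ)
    (hsymm : ∀ (σ : Equiv.Perm (Fin (n + 1))) (X : Config (n + 1)), Ψ (X ∘ σ) = Ψ X)
    (i : Fin (n + 1)) :
    ∫⁻ X, partialGradSq i Ψ X = ∫⁻ X, partialGradSq 0 Ψ X := by
  simp only [partialGradSq_eq_zero_comp_swap hΨ hsymm i]
  exact lintegral_comp_perm (Equiv.swap 0 i) (partialGradSq 0 Ψ)

/-- **`T = N · ∫ |∇₀Ψ|²`** for a Bose-symmetric differentiable `Ψ`. [folklore] -/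
theorem lintegral_kineticDensity_eq_mul {Ψ : Config (n + 1) → ℂ} (hΨ : Differentiable ℝ Ψ)
    (hsymm : ∀ (σ : Equiv.Perm (Fin (n + 1))) (X : Config (n + 1)), Ψ (X ∘ σ) = Ψ X) :
    ∫⁻ X, kineticDensity Ψ X = (n + 1 : ℝ≥0∞) * ∫⁻ X, partialGradSq 0 Ψ X := by
  simp only [kineticDensity_eq_sum_partialGradSq]
  rw [lintegral_finsetSum _ fun i _ => measurable_partialGradSq i Ψ]
  simp only [lintegral_partialGradSq_eq_zero hΨ hsymm, Finset.sum_const, Finset.card_univ,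
    Fintype.card_fin, nsmul_eq_mul]
  push_cast
  ring

/-! ### Slices along the first particle -/

/-- Adjoining the first particle after an update. [folklore] -/
theorem update_vecCons_zero (x z : Space) (Y : Config n) :
    Function.update (Matrix.vecCons x Y : Config (n + 1)) 0 z = Matrix.vecCons z Y := by
  funext j
  refine Fin.cases ?_ (fun j => ?_) j <;> simp

/-- Chain rule for the first slice: `|∇(x ↦ Ψ(x, Y))|²(x) = |∇₀Ψ|²(x, Y)`. [folklore] -/
theorem gradSqC_vecCons_eq_partialGradSq {Ψ : Config (n + 1) → ℂ} (hΨ : Differentiable ℝ Ψ) (x : Space)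
    (Y : Config n) :
    gradSqC (fun y => Ψ (Matrix.vecCons y Y)) x = partialGradSq 0 Ψ (Matrix.vecCons x Y) := by
  have h := gradSqC_slice hΨ (Matrix.vecCons x Y) 0 x
  simp only [update_vecCons_zero] at h
  exact h

/-- The first slice of a `C¹` function is `C¹`. [folklore] -/
theorem contDiff_vecCons_slice {Ψ : Config (n + 1) → ℂ} (hΨ : ContDiff ℝ 1 Ψ) (Y : Config n) :
    ContDiff ℝ 1 fun y => Ψ (Matrix.vecCons y Y) := by
  have h := hΨ.comp (contDiff_update 1 (Matrix.vecCons (0 : Space) Y : Config (n + 1)) 0)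
  simp only [Function.comp_def, update_vecCons_zero] at h
  exact h

/-- **`∫ |∇₀Ψ|² = ∫ dY ∫ dx |∇(x ↦ Ψ(x,Y))|²`** (Tonelli). [folklore] -/
theorem lintegral_partialGradSq_zero_eq {Ψ : Config (n + 1) → ℂ} (hΨ : Differentiable ℝ Ψ) :
    ∫⁻ X, partialGradSq 0 Ψ X = ∫⁻ Y, ∫⁻ x, gradSqC (fun y => Ψ (Matrix.vecCons y Y)) x := by
  simp only [gradSqC_vecCons_eq_partialGradSq hΨ]
  have hF : Measurable (partialGradSq 0 Ψ) := measurable_partialGradSq 0 Ψ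
  rw [← lintegral_lintegral_vecCons hF]
  exact lintegral_lintegral_swap ((hF.comp measurable_vecCons).aemeasurable)

/-- `Y ↦ ∫ dx |∇₀Ψ|²(x, Y)` is measurable. [folklore] -/
theorem measurable_lintegral_gradSqC_vecCons {Ψ : Config (n + 1) → ℂ} (hΨ : Differentiable ℝ Ψ) :
    Measurable fun Y : Config n => ∫⁻ x, gradSqC (fun y => Ψ (Matrix.vecCons y Y)) x := by
  simp only [gradSqC_vecCons_eq_partialGradSq hΨ]
  have hF : Measurable fun p : Space × Config n => partialGradSq 0 Ψ (Matrix.vecCons p.1 p.2) :=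
    (measurable_partialGradSq 0 Ψ).comp measurable_vecCons
  exact hF.lintegral_prod_left'


/-! ### Sub-cells of the big cell `[0, kℓ)³`: `k³` half-open cubes of side `ℓ` -/

/-- Index of a sub-cell. [folklore] -/
abbrev SubIdx (k : ℕ) : Type := Fin 3 → Fin k

variable {k : ℕ} {ℓ : ℝ}

/-- The offset `ℓ·q` of sub-cell `q`. [folklore] -/
def subOffset (ℓ : ℝ) (q : SubIdx k) : Space := WithLp.toLp 2 fun i => ℓ * ((q i : ℕ) : ℝ)

/-- Coordinates of the offset. [folklore] -/
@[simp] theorem subOffset_apply (ℓ : ℝ) (q : SubIdx k) (i : Fin 3) :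
    subOffset ℓ q i = ℓ * ((q i : ℕ) : ℝ) := rfl

/-- The translate `{x | x - a ∈ [0,ℓ)³}` of the cell. [folklore] -/
def cellShift (ℓ : ℝ) (a : Space) : Set Space := {x | x - a ∈ cell ℓ}

/-- Membership in a translated cell, in coordinates. [folklore] -/
theorem mem_cellShift {a x : Space} : x ∈ cellShift ℓ a ↔ ∀ i, a i ≤ x i ∧ x i < a i + ℓ := by
  simp only [cellShift, cell, Set.mem_setOf_eq, Set.mem_Ico, PiLp.sub_apply]
  refine forall_congr' fun i => ?_
  constructor <;> rintro ⟨h1, h2⟩ <;> constructor <;> linarith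

/-- Translated cells are measurable. [folklore] -/
theorem measurableSet_cellShift (ℓ : ℝ) (a : Space) : MeasurableSet (cellShift ℓ a) := by
  have : cellShift ℓ a = ⋂ i : Fin 3, (fun x : Space => x i) ⁻¹' Set.Ico (a i) (a i + ℓ) := by
    ext x; simp [mem_cellShift]
  rw [this]
  exact MeasurableSet.iInter fun i => measurableSet_Ico.preimage (by fun_prop)

/-- The sub-cell `q`: `ℓq + [0,ℓ)³`. [folklore] -/
def subCell (ℓ : ℝ) (q : SubIdx k) : Set Space := cellShift ℓ (subOffset ℓ q)

/-- Membership in a sub-cell, in coordinates. [folklore] -/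
theorem mem_subCell {q : SubIdx k} {x : Space} :
    x ∈ subCell ℓ q ↔ ∀ i, ℓ * ((q i : ℕ) : ℝ) ≤ x i ∧ x i < ℓ * ((q i : ℕ) : ℝ) + ℓ := by
  simp [subCell, mem_cellShift]

/-- Sub-cells are measurable. [folklore] -/
theorem measurableSet_subCell (ℓ : ℝ) (q : SubIdx k) : MeasurableSet (subCell ℓ q) :=
  measurableSet_cellShift ℓ _

/-- Distinct sub-cells are disjoint (`ℓ > 0`). [folklore] -/
theorem not_mem_subCell_of_ne (hℓ : 0 < ℓ) {q q' : SubIdx k} (hqq' : q ≠ q') {x : Space}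
    (hq : x ∈ subCell ℓ q) : x ∉ subCell ℓ q' := by
  intro hq'
  rw [mem_subCell] at hq hq'
  obtain ⟨i, hi⟩ : ∃ i, q i ≠ q' i := by
    by_contra h
    push Not at h
    exact hqq' (funext h)
  have hi' : (q i : ℕ) ≠ (q' i : ℕ) := fun h => hi (Fin.ext h)
  obtain ⟨h1, h2⟩ := hq i
  obtain ⟨h3, h4⟩ := hq' i
  rcases lt_or_gt_of_ne hi' with hlt | hlt
  · have : ((q i : ℕ) : ℝ) + 1 ≤ ((q' i : ℕ) : ℝ) := by exact_mod_cast hlt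
    nlinarith
  · have : ((q' i : ℕ) : ℝ) + 1 ≤ ((q i : ℕ) : ℝ) := by exact_mod_cast hlt
    nlinarith

/-- Every sub-cell lies in the big cell `[0, kℓ)³` (`ℓ > 0`). [folklore] -/
theorem subCell_subset_cell (hℓ : 0 < ℓ) (q : SubIdx k) : subCell ℓ q ⊆ cell (k * ℓ) := by
  intro x hx
  rw [mem_subCell] at hx
  intro i
  obtain ⟨h1, h2⟩ := hx i
  have h0 : (0 : ℝ) ≤ ((q i : ℕ) : ℝ) := Nat.cast_nonneg _
  have hqk : ((q i : ℕ) : ℝ) + 1 ≤ (k : ℝ) := by exact_mod_cast (q i).isLt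
  constructor <;> nlinarith

/-- Every point of the big cell lies in some sub-cell (`ℓ > 0`, `k ≥ 1`): `qᵢ = ⌊xᵢ/ℓ⌋`.
[folklore] -/
theorem exists_mem_subCell (hℓ : 0 < ℓ) {x : Space} (hx : x ∈ cell (k * ℓ)) :
    ∃ q : SubIdx k, x ∈ subCell ℓ q := by
  have hcoord : ∀ i, 0 ≤ x i ∧ x i < k * ℓ := fun i => hx i
  have hlt : ∀ i, ⌊x i / ℓ⌋₊ < k := by
    intro i
    refine (Nat.floor_lt (div_nonneg (hcoord i).1 hℓ.le)).2 ?_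
    rw [div_lt_iff₀ hℓ]
    exact (hcoord i).2
  refine ⟨fun i => ⟨⌊x i / ℓ⌋₊, hlt i⟩, ?_⟩
  rw [mem_subCell]
  intro i
  have hnn : 0 ≤ x i / ℓ := div_nonneg (hcoord i).1 hℓ.le
  have h1 : (⌊x i / ℓ⌋₊ : ℝ) ≤ x i / ℓ := Nat.floor_le hnn
  have h2 : x i / ℓ < (⌊x i / ℓ⌋₊ : ℝ) + 1 := Nat.lt_floor_add_one _
  rw [le_div_iff₀ hℓ] at h1
  rw [div_lt_iff₀ hℓ] at h2
  constructor <;> nlinarith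

/-- **The sub-cells partition the big cell**: `∑_q 1_{Q_q} h = 1_{[0,kℓ)³} h` pointwise. [folklore] -/
theorem sum_indicator_subCell (hℓ : 0 < ℓ) (h : Space → ℝ≥0∞) (x : Space) :
    ∑ q : SubIdx k, (subCell ℓ q).indicator h x = (cell (k * ℓ)).indicator h x := by
  classical
  by_cases hx : x ∈ cell (k * ℓ)
  · obtain ⟨q₀, hq₀⟩ := exists_mem_subCell hℓ hx
    rw [Set.indicator_of_mem hx, Finset.sum_eq_single q₀
      (fun q _ hq => Set.indicator_of_notMem (not_mem_subCell_of_ne hℓ (Ne.symm hq) hq₀) h)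
      (fun h => absurd (Finset.mem_univ _) h), Set.indicator_of_mem hq₀]
  · rw [Set.indicator_of_notMem hx]
    refine Finset.sum_eq_zero fun q _ => Set.indicator_of_notMem (fun h => hx ?_) h
    exact subCell_subset_cell hℓ q h

/-- Hence `∑_q ∫_{Q_q} h = ∫_{[0,kℓ)³} h`. [folklore] -/
theorem sum_setLIntegral_subCell (hℓ : 0 < ℓ) {h : Space → ℝ≥0∞} (hm : AEMeasurable h volume) :
    ∑ q : SubIdx k, ∫⁻ x in subCell ℓ q, h x = ∫⁻ x in cell (k * ℓ), h x := by
  calc ∑ q : SubIdx k, ∫⁻ x in subCell ℓ q, h x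
      = ∑ q : SubIdx k, ∫⁻ x, (subCell ℓ q).indicator h x :=
        Finset.sum_congr rfl fun q _ => (lintegral_indicator (measurableSet_subCell ℓ q) _).symm
    _ = ∫⁻ x, ∑ q : SubIdx k, (subCell ℓ q).indicator h x :=
        (lintegral_finsetSum' _ fun q _ => hm.indicator (measurableSet_subCell ℓ q)).symm
    _ = ∫⁻ x in cell (k * ℓ), h x := by
        simp only [sum_indicator_subCell hℓ]
        exact lintegral_indicator (measurableSet_cell _) _

/-- … and `∑_q ∫_{Q_q} h ≤ ∫ h`. [folklore] -/
theorem sum_setLIntegral_subCell_le (hℓ : 0 < ℓ) {h : Space → ℝ≥0∞} (hm : AEMeasurable h volume) :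
    ∑ q : SubIdx k, ∫⁻ x in subCell ℓ q, h x ≤ ∫⁻ x, h x := by
  rw [sum_setLIntegral_subCell hℓ hm]
  exact setLIntegral_le_lintegral _ _

/-! ### Translation of cell integrals -/

/-- `∫_{[0,ℓ)³} H(x + a) dx = ∫_{a + [0,ℓ)³} H`. [folklore] -/
theorem setLIntegral_cell_comp_add (ℓ : ℝ) (H : Space → ℝ≥0∞) (a : Space) :
    ∫⁻ x in cell ℓ, H (x + a) = ∫⁻ x in cellShift ℓ a, H x := by
  rw [← lintegral_indicator (measurableSet_cell ℓ), ← lintegral_indicator (measurableSet_cellShift ℓ a)]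
  have : (cell ℓ).indicator (fun x => H (x + a)) = fun x => (cellShift ℓ a).indicator H (x + a) := by
    funext x
    have hiff : x ∈ cell ℓ ↔ x + a ∈ cellShift ℓ a := by simp [cellShift]
    by_cases hx : x ∈ cell ℓ
    · rw [Set.indicator_of_mem hx, Set.indicator_of_mem (hiff.1 hx)]
    · rw [Set.indicator_of_notMem hx, Set.indicator_of_notMem (fun h => hx (hiff.2 h))]
  rw [this]
  exact lintegral_add_right_eq_self (fun x => (cellShift ℓ a).indicator H x) a

/-- `∫_{[0,ℓ)³} f(x + a) dx = ∫_{a + [0,ℓ)³} f` (Bochner). [folklore] -/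
theorem setIntegral_cell_comp_add (ℓ : ℝ) (f : Space → ℂ) (a : Space) :
    ∫ x in cell ℓ, f (x + a) = ∫ x in cellShift ℓ a, f x := by
  rw [← integral_indicator (measurableSet_cell ℓ), ← integral_indicator (measurableSet_cellShift ℓ a)]
  have : (cell ℓ).indicator (fun x => f (x + a)) = fun x => (cellShift ℓ a).indicator f (x + a) := by
    funext x
    have hiff : x ∈ cell ℓ ↔ x + a ∈ cellShift ℓ a := by simp [cellShift]
    by_cases hx : x ∈ cell ℓ
    · rw [Set.indicator_of_mem hx, Set.indicator_of_mem (hiff.1 hx)]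
    · rw [Set.indicator_of_notMem hx, Set.indicator_of_notMem (fun h => hx (hiff.2 h))]
  rw [this]
  exact integral_add_right_eq_self (fun x => (cellShift ℓ a).indicator f x) a

/-- The gradient square is translation covariant. [folklore] -/
theorem gradSqC_comp_add (f : Space → ℂ) (a x : Space) :
    gradSqC (fun y => f (y + a)) x = gradSqC f (x + a) := by
  simp only [gradSqC, fderiv_comp_add_right]

/-! ### The sharp Poincaré inequality on a translated cell, additive form -/

/-- **Localised sharp Poincaré** (Neumann gap `π²/ℓ²` of the cube, from the cosine Parseval of the
tree): for `f ∈ C¹(ℝ³)` and every translate `Q = a + [0,ℓ)³`,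
`(π/ℓ)² ∫_Q |f|² ≤ ∫_Q |∇f|² + (π/ℓ)² ℓ⁻³ |∫_Q f|²`. [cite: LSSY2005, Ch. 5 (5.15)–(5.17)] -/
theorem local_poincare_cellShift (hℓ : 0 < ℓ) {f : Space → ℂ} (hf : ContDiff ℝ 1 f) (a : Space) :
    ENNReal.ofReal ((Real.pi / ℓ) ^ 2) * ∫⁻ x in cellShift ℓ a, (‖f x‖₊ : ℝ≥0∞) ^ 2 ≤
      (∫⁻ x in cellShift ℓ a, gradSqC f x) +
        ENNReal.ofReal ((Real.pi / ℓ) ^ 2) *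
          ((ENNReal.ofReal ℓ ^ 3)⁻¹ * (‖∫ x in cellShift ℓ a, f x‖₊ : ℝ≥0∞) ^ 2) := by
  set g : Space → ℂ := fun y => f (y + a) with hg
  have hgd : ContDiff ℝ 1 g := hf.comp (contDiff_id.add contDiff_const)
  have hgap := NeumannBox.gap_mul_lowOccupation_add_mul_highOccupation_le (K := Real.pi)
    Real.pi_pos.le hℓ hgd
  have hvar := NeumannBox.lowOccupation_add_highOccupation_eq (K := Real.pi) Real.pi_pos.le hℓ
    hgd.continuous
  have hpyth := Literature.Barriers.AtomisticToContinuum.BoseGas.lintegral_nnnorm_sq_cell_eq hℓ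
    hgd.continuous
  -- everything in terms of `g` on the cell
  have h1 : ∫⁻ x in cellShift ℓ a, (‖f x‖₊ : ℝ≥0∞) ^ 2 = ∫⁻ x in cell ℓ, (‖g x‖₊ : ℝ≥0∞) ^ 2 :=
    (setLIntegral_cell_comp_add ℓ (fun x => (‖f x‖₊ : ℝ≥0∞) ^ 2) a).symm
  have h2 : ∫⁻ x in cellShift ℓ a, gradSqC f x = ∫⁻ x in cell ℓ, gradSqC g x := by
    rw [← setLIntegral_cell_comp_add ℓ (gradSqC f) a]
    simp only [hg, gradSqC_comp_add]
  have h3 : ∫ x in cellShift ℓ a, f x = ∫ x in cell ℓ, g x := (setIntegral_cell_comp_add ℓ f a).symm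
  rw [h1, h2, h3, hpyth, mul_add]
  gcongr
  simp only [enorm_eq_nnnorm] at hgap hvar
  rw [← hvar, mul_add]
  exact hgap


/-! ### The sub-cell modes and their occupations -/

/-- The normalised constant mode `u_q = ℓ^{-3/2} 1_{Q_q}` of sub-cell `q`. [folklore] -/
def subMode (ℓ : ℝ) (q : SubIdx k) (x : Space) : ℂ := constantMode ℓ (x - subOffset ℓ q)

/-- The sub-cell mode as an indicator. [folklore] -/
theorem subMode_eq_indicator (ℓ : ℝ) (q : SubIdx k) :
    subMode ℓ q = (subCell ℓ q).indicator fun _ => ((Real.sqrt (ℓ ^ 3))⁻¹ : ℂ) := by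
  funext x
  unfold subMode constantMode
  by_cases hx : x ∈ subCell ℓ q
  · have hx' : x - subOffset ℓ q ∈ cell ℓ := hx
    rw [Set.indicator_of_mem hx', Set.indicator_of_mem hx]
  · have hx' : x - subOffset ℓ q ∉ cell ℓ := hx
    rw [Set.indicator_of_notMem hx', Set.indicator_of_notMem hx]

/-- The sub-cell modes are a.e.-strongly measurable. [folklore] -/
theorem aestronglyMeasurable_subMode (ℓ : ℝ) (q : SubIdx k) :
    AEStronglyMeasurable (subMode ℓ q) volume := by
  rw [subMode_eq_indicator]
  exact aestronglyMeasurable_const.indicator (measurableSet_subCell ℓ q)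

/-- The sub-cell modes are normalised (`ℓ > 0`). [folklore] -/
theorem lintegral_subMode_sq (hℓ : 0 < ℓ) (q : SubIdx k) :
    ∫⁻ x, (‖subMode ℓ q x‖₊ : ℝ≥0∞) ^ 2 = 1 := by
  unfold subMode
  rw [lintegral_sub_right_eq_self (fun x => (‖constantMode ℓ x‖₊ : ℝ≥0∞) ^ 2) (subOffset ℓ q)]
  exact lintegral_constantMode_sq hℓ

/-- The pairing of a sub-cell mode with a slice. [folklore] -/
theorem integral_conj_subMode_mul (ℓ : ℝ) (q : SubIdx k) (Ψ : Config (n + 1) → ℂ) (Y : Config n) :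
    ∫ x, conj (subMode ℓ q x) * Ψ (Matrix.vecCons x Y) =
      ((Real.sqrt (ℓ ^ 3))⁻¹ : ℂ) * ∫ x in subCell ℓ q, Ψ (Matrix.vecCons x Y) := by
  have h : (fun x => conj (subMode ℓ q x) * Ψ (Matrix.vecCons x Y)) =
      (subCell ℓ q).indicator fun x => ((Real.sqrt (ℓ ^ 3))⁻¹ : ℂ) * Ψ (Matrix.vecCons x Y) := by
    funext x
    rw [subMode_eq_indicator]
    by_cases hx : x ∈ subCell ℓ q
    · rw [Set.indicator_of_mem hx, Set.indicator_of_mem hx]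
      congr 1
      rw [← Complex.ofReal_inv, Complex.conj_ofReal]
    · rw [Set.indicator_of_notMem hx, Set.indicator_of_notMem hx, map_zero, zero_mul]
  rw [h, integral_indicator (measurableSet_subCell ℓ q), integral_const_mul]


/-- **Occupation of a sub-cell mode through slices**:
`⟨u_q, γ_Ψ u_q⟩ = N ℓ⁻³ ∫ dY |∫_{Q_q} Ψ(x, Y) dx|²`. [cite: LSSY2005, §1.2 (1.17)] -/
theorem occupation_subMode (hℓ : 0 < ℓ) (q : SubIdx k) (Ψ : Config (n + 1) → ℂ) :
    occupation (n + 1) (subMode ℓ q) Ψ =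
      (n + 1 : ℝ≥0∞) * ∫⁻ Y : Config n, (ENNReal.ofReal ℓ ^ 3)⁻¹ *
        (‖∫ x in subCell ℓ q, Ψ (Matrix.vecCons x Y)‖₊ : ℝ≥0∞) ^ 2 := by
  unfold occupation
  push_cast
  congr 1
  refine lintegral_congr fun Y => ?_
  rw [integral_conj_subMode_mul, nnnorm_mul, ENNReal.coe_mul, mul_pow, nnnorm_constantMode_sq hℓ]

/-- Measurability of `Y ↦ |∫_Q Ψ(x, Y) dx|²` for continuous `Ψ`. [folklore] -/
theorem measurable_sliceSetIntegral_sq {Ψ : Config (n + 1) → ℂ} (hΨ : Continuous Ψ) (Q : Set Space) :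
    Measurable fun Y : Config n => (‖∫ x in Q, Ψ (Matrix.vecCons x Y)‖₊ : ℝ≥0∞) ^ 2 := by
  have h : StronglyMeasurable
      (Function.uncurry fun (Y : Config n) (x : Space) => Ψ (Matrix.vecCons x Y)) :=
    (hΨ.comp (continuous_snd.matrixVecCons continuous_fst)).stronglyMeasurable
  have h2 : StronglyMeasurable fun Y : Config n => ∫ x in Q, Ψ (Matrix.vecCons x Y) :=
    h.integral_prod_right' (ν := volume.restrict Q)
  exact (h2.measurable.nnnorm.coe_nnreal_ennreal).pow_const _

/-- `|∇f|²` is measurable for any `f : ℝ³ → ℂ`. [folklore] -/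
theorem measurable_gradSqC_any (f : Space → ℂ) : Measurable (gradSqC f) := by
  refine Finset.measurable_sum _ fun k _ => ?_
  exact ((measurable_fderiv_apply_const ℝ f _).nnnorm.coe_nnreal_ennreal).pow_const _

/-! ### The key inequality: `N ≤ (ℓ/π)² T + ∑_q ⟨u_q, γ_Ψ u_q⟩` -/

section Key

variable {L : ℝ}

/-- **One slice**: for a Dirichlet state of `Λ_L`, `L = kℓ`, and every `Y`,
`(π/ℓ)² ∫ |Ψ(x,Y)|² dx ≤ ∫ |∇ₓΨ(x,Y)|² dx + (π/ℓ)² ℓ⁻³ ∑_q |∫_{Q_q} Ψ(x,Y) dx|²`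
(localised Poincaré on each sub-cell, summed; the sub-cells partition the support).
[cite: LSSY2005, Ch. 5 (5.15)–(5.17)] -/
theorem slice_key (hℓ : 0 < ℓ) (hkℓ : (k : ℝ) * ℓ = L) (Ψ : TrialState (n + 1) L) (Y : Config n) :
    ENNReal.ofReal ((Real.pi / ℓ) ^ 2) * ∫⁻ x, (‖Ψ.ψ (Matrix.vecCons x Y)‖₊ : ℝ≥0∞) ^ 2 ≤
      (∫⁻ x, gradSqC (fun y => Ψ.ψ (Matrix.vecCons y Y)) x) +
        ENNReal.ofReal ((Real.pi / ℓ) ^ 2) * ∑ q : SubIdx k,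
          (ENNReal.ofReal ℓ ^ 3)⁻¹ * (‖∫ x in subCell ℓ q, Ψ.ψ (Matrix.vecCons x Y)‖₊ : ℝ≥0∞) ^ 2 := by
  set f : Space → ℂ := fun y => Ψ.ψ (Matrix.vecCons y Y) with hf
  have hfd : ContDiff ℝ 1 f := contDiff_vecCons_slice Ψ.contDiff Y
  -- the slice vanishes off the big cell
  have hsupp : Function.support (fun x => (‖f x‖₊ : ℝ≥0∞) ^ 2) ⊆ cell (k * ℓ) := by
    intro x hx
    by_contra hxc
    apply hx
    have hbox : (Matrix.vecCons x Y : Config (n + 1)) ∉ boxN (n + 1) L := by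
      intro h
      have h0 : x ∈ box L := by simpa using h 0
      rw [hkℓ] at hxc
      exact hxc fun i => ⟨(h0 i).1.le, (h0 i).2⟩
    simp [hf, Ψ.eq_zero _ hbox]
  have hnorm : ∫⁻ x, (‖f x‖₊ : ℝ≥0∞) ^ 2 = ∑ q : SubIdx k, ∫⁻ x in subCell ℓ q, (‖f x‖₊ : ℝ≥0∞) ^ 2 := by
    rw [sum_setLIntegral_subCell hℓ
        (hfd.continuous.measurable.nnnorm.coe_nnreal_ennreal.pow_const 2).aemeasurable,
      setLIntegral_eq_of_support_subset hsupp]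
  have hgrad : ∑ q : SubIdx k, ∫⁻ x in subCell ℓ q, gradSqC f x ≤ ∫⁻ x, gradSqC f x :=
    sum_setLIntegral_subCell_le hℓ (measurable_gradSqC_any f).aemeasurable
  have hloc : ∀ q : SubIdx k,
      ENNReal.ofReal ((Real.pi / ℓ) ^ 2) * ∫⁻ x in subCell ℓ q, (‖f x‖₊ : ℝ≥0∞) ^ 2 ≤
        (∫⁻ x in subCell ℓ q, gradSqC f x) + ENNReal.ofReal ((Real.pi / ℓ) ^ 2) *
          ((ENNReal.ofReal ℓ ^ 3)⁻¹ * (‖∫ x in subCell ℓ q, f x‖₊ : ℝ≥0∞) ^ 2) :=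
    fun q => local_poincare_cellShift hℓ hfd (subOffset ℓ q)
  calc ENNReal.ofReal ((Real.pi / ℓ) ^ 2) * ∫⁻ x, (‖f x‖₊ : ℝ≥0∞) ^ 2
      = ∑ q : SubIdx k, ENNReal.ofReal ((Real.pi / ℓ) ^ 2) *
          ∫⁻ x in subCell ℓ q, (‖f x‖₊ : ℝ≥0∞) ^ 2 := by rw [hnorm, Finset.mul_sum]
    _ ≤ ∑ q : SubIdx k, ((∫⁻ x in subCell ℓ q, gradSqC f x) + ENNReal.ofReal ((Real.pi / ℓ) ^ 2) *
          ((ENNReal.ofReal ℓ ^ 3)⁻¹ * (‖∫ x in subCell ℓ q, f x‖₊ : ℝ≥0∞) ^ 2)) :=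
        Finset.sum_le_sum fun q _ => hloc q
    _ = (∑ q : SubIdx k, ∫⁻ x in subCell ℓ q, gradSqC f x) + ENNReal.ofReal ((Real.pi / ℓ) ^ 2) *
          ∑ q : SubIdx k, (ENNReal.ofReal ℓ ^ 3)⁻¹ * (‖∫ x in subCell ℓ q, f x‖₊ : ℝ≥0∞) ^ 2 := by
        rw [Finset.sum_add_distrib, Finset.mul_sum]
    _ ≤ _ := by gcongr

/-- **The key inequality** for a Dirichlet state of `Λ_L`, `L = kℓ`, free gas:
`(π/ℓ)² N ≤ T(Ψ) + (π/ℓ)² ∑_q ⟨u_q, γ_Ψ u_q⟩` — every particle is either kinetically excited at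
the sub-cell gap or condensed into one of the `k³` sub-cell constant modes.
[cite: LSSY2005, Ch. 5 (5.15)–(5.17)] -/
theorem key_inequality (hℓ : 0 < ℓ) (hkℓ : (k : ℝ) * ℓ = L) (Ψ : TrialState (n + 1) L) :
    ENNReal.ofReal ((Real.pi / ℓ) ^ 2) * (n + 1 : ℝ≥0∞) ≤
      energy 0 Ψ + ENNReal.ofReal ((Real.pi / ℓ) ^ 2) *
        ∑ q : SubIdx k, occupation (n + 1) (subMode ℓ q) Ψ.ψ := by
  set C := ENNReal.ofReal ((Real.pi / ℓ) ^ 2) with hC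
  have hcont : Continuous Ψ.ψ := Ψ.contDiff.continuous
  have hdiff : Differentiable ℝ Ψ.ψ := Ψ.contDiff.differentiable one_ne_zero
  -- integrate the slice inequality over `Y`
  have hint := lintegral_mono (μ := (volume : Measure (Config n))) fun Y => slice_key hℓ hkℓ Ψ Y
  -- left-hand side: `C · ∫|Ψ|² = C`
  have hL1 : ∫⁻ Y : Config n, C * ∫⁻ x, (‖Ψ.ψ (Matrix.vecCons x Y)‖₊ : ℝ≥0∞) ^ 2 = C := by
    have hF : Measurable fun X : Config (n + 1) => (‖Ψ.ψ X‖₊ : ℝ≥0∞) ^ 2 := measurable_normSq hcont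
    have hsw : AEMeasurable (Function.uncurry fun (Y : Config n) (x : Space) =>
        (‖Ψ.ψ (Matrix.vecCons x Y)‖₊ : ℝ≥0∞) ^ 2) (volume.prod volume) :=
      ((hF.comp measurable_vecCons).comp measurable_swap).aemeasurable
    rw [lintegral_const_mul' _ _ ENNReal.ofReal_ne_top, lintegral_lintegral_swap hsw,
      lintegral_lintegral_vecCons hF, Ψ.norm_eq, mul_one]
  -- right-hand side
  have hA : Measurable fun Y : Config n => ∫⁻ x, gradSqC (fun y => Ψ.ψ (Matrix.vecCons y Y)) x :=
    measurable_lintegral_gradSqC_vecCons hdiff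
  have hBq : ∀ q : SubIdx k, Measurable fun Y : Config n =>
      (ENNReal.ofReal ℓ ^ 3)⁻¹ * (‖∫ x in subCell ℓ q, Ψ.ψ (Matrix.vecCons x Y)‖₊ : ℝ≥0∞) ^ 2 :=
    fun q => (measurable_sliceSetIntegral_sq hcont _).const_mul _
  have hR : ∫⁻ Y : Config n, ((∫⁻ x, gradSqC (fun y => Ψ.ψ (Matrix.vecCons y Y)) x) +
      C * ∑ q : SubIdx k, (ENNReal.ofReal ℓ ^ 3)⁻¹ *
        (‖∫ x in subCell ℓ q, Ψ.ψ (Matrix.vecCons x Y)‖₊ : ℝ≥0∞) ^ 2) =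
      (∫⁻ X, partialGradSq 0 Ψ.ψ X) + C * ∑ q : SubIdx k, ∫⁻ Y : Config n,
        (ENNReal.ofReal ℓ ^ 3)⁻¹ * (‖∫ x in subCell ℓ q, Ψ.ψ (Matrix.vecCons x Y)‖₊ : ℝ≥0∞) ^ 2 := by
    rw [lintegral_add_left hA, lintegral_partialGradSq_zero_eq hdiff,
      lintegral_const_mul' _ _ ENNReal.ofReal_ne_top, lintegral_finsetSum _ fun q _ => hBq q]
  rw [hL1, hR] at hint
  -- multiply by `N = n + 1`
  have hT : (n + 1 : ℝ≥0∞) * ∫⁻ X, partialGradSq 0 Ψ.ψ X = energy 0 Ψ := by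
    rw [← lintegral_kineticDensity_eq_mul hdiff Ψ.symm, energy]
    simp
  have hocc : ∀ q : SubIdx k, (n + 1 : ℝ≥0∞) * ∫⁻ Y : Config n, (ENNReal.ofReal ℓ ^ 3)⁻¹ *
      (‖∫ x in subCell ℓ q, Ψ.ψ (Matrix.vecCons x Y)‖₊ : ℝ≥0∞) ^ 2 =
      occupation (n + 1) (subMode ℓ q) Ψ.ψ := fun q => (occupation_subMode hℓ q Ψ.ψ).symm
  calc C * (n + 1 : ℝ≥0∞) = (n + 1 : ℝ≥0∞) * C := mul_comm _ _
    _ ≤ (n + 1 : ℝ≥0∞) * ((∫⁻ X, partialGradSq 0 Ψ.ψ X) + C * ∑ q : SubIdx k, ∫⁻ Y : Config n,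
        (ENNReal.ofReal ℓ ^ 3)⁻¹ * (‖∫ x in subCell ℓ q, Ψ.ψ (Matrix.vecCons x Y)‖₊ : ℝ≥0∞) ^ 2) := by
        gcongr
    _ = energy 0 Ψ + C * ∑ q : SubIdx k, occupation (n + 1) (subMode ℓ q) Ψ.ψ := by
        rw [mul_add, hT, Finset.mul_sum, Finset.mul_sum, Finset.mul_sum]
        congr 1
        refine Finset.sum_congr rfl fun q _ => ?_
        rw [← hocc q]
        ring

end Key


/-! ### Conclusion: the free Dirichlet gas condenses -/

section Conclusion

variable {L : ℝ}

/-- **`E₀^D(0, N, L) ≤ N 𝓔₀[β] / L²`**: the dilated power state `β_L^{⊗N}` of the unit bump.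
[folklore] -/
theorem groundStateEnergy_zero_le (hL : 0 < L) (N : ℕ) :
    groundStateEnergy 0 N L ≤ ENNReal.ofReal (L ^ 2)⁻¹ * (N * energy 0 unitBump) := by
  have h := TrialState.energy_dilate 0 (powState N) hL
  rw [scalePotential_zero, energy_powState] at h
  calc groundStateEnergy 0 N L = groundStateEnergy 0 N (L * 1) := by rw [mul_one]
    _ ≤ energy 0 ((powState N).dilate hL) := groundStateEnergy_le_energy _ _
    _ = _ := h

/-- A sum over a finite non-empty index type is at most the cardinality times its largest term.
[folklore] -/
theorem exists_sum_le_card_mul {ι : Type*} [Fintype ι] [Nonempty ι] (g : ι → ℝ≥0∞) :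
    ∃ i, ∑ j, g j ≤ (Fintype.card ι : ℝ≥0∞) * g i := by
  classical
  obtain ⟨i, -, hi⟩ := Finset.exists_max_image Finset.univ g Finset.univ_nonempty
  refine ⟨i, ?_⟩
  calc ∑ j, g j ≤ ∑ _j : ι, g i := Finset.sum_le_sum fun j _ => hi j (Finset.mem_univ j)
    _ = (Fintype.card ι : ℝ≥0∞) * g i := by
        rw [Finset.sum_const, Finset.card_univ, nsmul_eq_mul]

/-- **Uniform condensate bound for the free Dirichlet gas**: there is `c > 0` with
`λ_max(γ_{Ψ₀}) ≥ cN` — in the sense of `condensateNumber` — for EVERY particle number `N ≥ 1` and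
EVERY box `Λ_L` (scale invariance). Proof: `k` sub-cells per axis with `k²π²/4 ≥ 𝓔₀[β]`; the key
inequality with `ℓ = L/k` and slack `δ = (πk/L)² N/4` gives `∑_q ⟨u_q, γ u_q⟩ ≥ N/2`, so one of
the `k³` sub-cell modes carries `≥ N/(2k³)`. [folklore] -/
theorem exists_condensateNumber_zero_ge :
    ∃ c : ℝ, 0 < c ∧ ∀ (n : ℕ) (L : ℝ), 0 < L →
      ENNReal.ofReal (c * (n + 1 : ℕ)) ≤ condensateNumber 0 (n + 1) L := by
  -- the constants
  set E₁ : ℝ := (energy 0 unitBump).toReal with hE₁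
  have hE₁0 : 0 ≤ E₁ := ENNReal.toReal_nonneg
  have hEeq : energy 0 unitBump = ENNReal.ofReal E₁ := energy_unitBump_eq_ofReal
  set k : ℕ := ⌈E₁⌉₊ + 1 with hk
  have hk1 : 1 ≤ k := by omega
  have hk0 : 0 < (k : ℝ) := by exact_mod_cast hk1
  have hkE : E₁ ≤ Real.pi ^ 2 * k ^ 2 / 4 := by
    have h1 : E₁ ≤ (k : ℝ) := by
      have := Nat.le_ceil E₁
      rw [hk]; push_cast; linarith
    have h2 : (k : ℝ) ≤ (k : ℝ) ^ 2 := by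
      have : (1 : ℝ) ≤ k := by exact_mod_cast hk1
      nlinarith
    have hπ : (9 : ℝ) < Real.pi ^ 2 := by nlinarith [Real.pi_gt_three]
    nlinarith
  refine ⟨1 / (2 * (k : ℝ) ^ 3), by positivity, fun n L hL => ?_⟩
  -- scales
  set ℓ : ℝ := L / k with hℓ
  have hℓ0 : 0 < ℓ := by positivity
  have hkℓ : (k : ℝ) * ℓ = L := by rw [hℓ]; field_simp
  set δr : ℝ := (Real.pi / ℓ) ^ 2 / 4 * (n + 1) with hδr
  have hδr0 : 0 < δr := by positivity
  set Cq : ℝ := (Real.pi / ℓ) ^ 2 with hCq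
  have hCq0 : 0 < Cq := by positivity
  refine le_condensateNumber 0 (δ := ENNReal.ofReal δr) (by rwa [ENNReal.ofReal_pos]) fun Ψ hΨ => ?_
  -- the key inequality in scaled form
  have hkey := key_inequality (k := k) hℓ0 hkℓ Ψ
  have hE := (hΨ.trans (add_le_add_left (groundStateEnergy_zero_le hL (n + 1)) _))
  -- `energy ≤ (n+1) E₁ / L² + δ`
  have hT : energy 0 Ψ ≤ ENNReal.ofReal (Cq * ((n + 1) / 4)) + ENNReal.ofReal (Cq * ((n + 1) / 4)) := by
    refine hE.trans (add_le_add ?_ (le_of_eq ?_))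
    · rw [hEeq, show ((n + 1 : ℕ) : ℝ≥0∞) = ENNReal.ofReal (n + 1) by
          rw [← ENNReal.ofReal_natCast]; push_cast; rfl,
        ← ENNReal.ofReal_mul (by positivity), ← ENNReal.ofReal_mul (by positivity)]
      refine ENNReal.ofReal_le_ofReal ?_
      have hL2 : (L ^ 2)⁻¹ * ((n + 1) * E₁) = (E₁ / L ^ 2) * (n + 1) := by field_simp
      rw [hL2]
      have h1 : E₁ / L ^ 2 ≤ Cq / 4 := by
        rw [hCq, hℓ, div_le_div_iff₀ (by positivity) (by positivity)]
        have : (Real.pi / (L / k)) ^ 2 = Real.pi ^ 2 * k ^ 2 / L ^ 2 := by field_simp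
        rw [this]
        have hL2' : 0 < L ^ 2 := by positivity
        calc E₁ * 4 ≤ Real.pi ^ 2 * k ^ 2 := by linarith
          _ = Real.pi ^ 2 * k ^ 2 / L ^ 2 * L ^ 2 := by field_simp
      have hn : (0 : ℝ) ≤ n + 1 := by positivity
      nlinarith
    · rw [hδr, hCq]; ring_nf
  -- combine: `Cq (n+1) ≤ Cq (n+1)/2 + Cq Σ occ`
  have hsum : ENNReal.ofReal Cq * (n + 1 : ℝ≥0∞) ≤
      ENNReal.ofReal (Cq * ((n + 1) / 2)) +
        ENNReal.ofReal Cq * ∑ q : SubIdx k, occupation (n + 1) (subMode ℓ q) Ψ.ψ := by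
    refine hkey.trans (add_le_add (hT.trans (le_of_eq ?_)) le_rfl)
    rw [← ENNReal.ofReal_add (by positivity) (by positivity)]
    congr 1; ring
  have hhalf : ENNReal.ofReal Cq * (n + 1 : ℝ≥0∞) =
      ENNReal.ofReal (Cq * ((n + 1) / 2)) + ENNReal.ofReal (Cq * ((n + 1) / 2)) := by
    have hn1 : (n + 1 : ℝ≥0∞) = ENNReal.ofReal (n + 1) := by
      rw [ENNReal.ofReal_add (Nat.cast_nonneg _) zero_le_one, ENNReal.ofReal_natCast,
        ENNReal.ofReal_one]
    rw [← ENNReal.ofReal_add (by positivity) (by positivity), hn1,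
      ← ENNReal.ofReal_mul (by positivity)]
    congr 1; ring
  rw [hhalf] at hsum
  have hocc : ENNReal.ofReal (Cq * ((n + 1) / 2)) ≤
      ENNReal.ofReal Cq * ∑ q : SubIdx k, occupation (n + 1) (subMode ℓ q) Ψ.ψ :=
    (ENNReal.add_le_add_iff_left ENNReal.ofReal_ne_top).1 hsum
  rw [ENNReal.ofReal_mul hCq0.le] at hocc
  have hocc' : ENNReal.ofReal ((n + 1) / 2) ≤ ∑ q : SubIdx k, occupation (n + 1) (subMode ℓ q) Ψ.ψ :=
    (ENNReal.mul_le_mul_iff_right (by rwa [ne_eq, ENNReal.ofReal_eq_zero, not_le]) ENNReal.ofReal_ne_top).1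
      hocc
  -- one sub-cell mode carries `≥ (n+1)/(2k³)`
  haveI : Nonempty (SubIdx k) := ⟨fun _ => ⟨0, hk1⟩⟩
  obtain ⟨q, hq⟩ := exists_sum_le_card_mul fun q : SubIdx k => occupation (n + 1) (subMode ℓ q) Ψ.ψ
  have hcard : (Fintype.card (SubIdx k) : ℝ≥0∞) = ENNReal.ofReal ((k : ℝ) ^ 3) := by
    rw [show Fintype.card (SubIdx k) = k ^ 3 by simp, ← ENNReal.ofReal_natCast]
    push_cast; rfl
  have hfin : ENNReal.ofReal ((n + 1) / 2) ≤
      ENNReal.ofReal ((k : ℝ) ^ 3) * occupation (n + 1) (subMode ℓ q) Ψ.ψ := by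
    rw [← hcard]; exact hocc'.trans hq
  have hk3 : (0 : ℝ) < (k : ℝ) ^ 3 := by positivity
  calc ENNReal.ofReal (1 / (2 * (k : ℝ) ^ 3) * ((n + 1 : ℕ) : ℝ))
      = (ENNReal.ofReal ((k : ℝ) ^ 3))⁻¹ * ENNReal.ofReal ((n + 1) / 2) := by
        rw [← ENNReal.ofReal_inv_of_pos hk3, ← ENNReal.ofReal_mul (by positivity)]
        congr 1; push_cast; field_simp
    _ ≤ (ENNReal.ofReal ((k : ℝ) ^ 3))⁻¹ *
          (ENNReal.ofReal ((k : ℝ) ^ 3) * occupation (n + 1) (subMode ℓ q) Ψ.ψ) := by gcongr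
    _ = occupation (n + 1) (subMode ℓ q) Ψ.ψ := by
        rw [← mul_assoc, ENNReal.inv_mul_cancel (by rwa [ne_eq, ENNReal.ofReal_eq_zero, not_le])
          ENNReal.ofReal_ne_top, one_mul]
    _ ≤ maxOccupation (n + 1) Ψ.ψ :=
        occupation_le_maxOccupation Ψ.ψ (aestronglyMeasurable_subMode ℓ q) (lintegral_subMode_sq hℓ0 q)

/-- **The free Dirichlet gas has ground-state Bose–Einstein condensation at every density**
(`HasGroundStateBEC 0 ρ`): the `v = 0` instance of the conjunct `BoseEinsteinCondensation` holds.
[folklore] -/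
theorem hasGroundStateBEC_zero {ρ : ℝ} (hρ : 0 < ρ) : HasGroundStateBEC 0 ρ := by
  obtain ⟨c, hc, h⟩ := exists_condensateNumber_zero_ge
  refine ⟨c, hc, ?_⟩
  filter_upwards [eventually_gt_atTop 0] with N hN
  obtain ⟨n, rfl⟩ : ∃ n, N = n + 1 := ⟨N - 1, by omega⟩
  exact h n (sideLength ρ (n + 1)) (sideLength_pos_of_pos hρ hN)

/-- **The conjunct `BoseEinsteinCondensation` holds at `v = 0`** (its `∃ ρ₀ ∀ ρ < ρ₀` form, with any
`ρ₀`): the audited statement is not refutable at the free gas. [folklore] -/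
theorem boseEinsteinCondensation_at_zero :
    ∃ ρ₀ : ℝ, 0 < ρ₀ ∧ ∀ ρ : ℝ, 0 < ρ → ρ < ρ₀ → HasGroundStateBEC 0 ρ :=
  ⟨1, one_pos, fun _ hρ _ => hasGroundStateBEC_zero hρ⟩

end Conclusion

end Literature.MathematicalPhysics.QuantumManyBody.BoseGas

end
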